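import Summits.AtomisticToContinuum.HydrodynamicLimit.Theorems.InformationPercolationEngineChaosClosesEulerShellL1
import Mathlib.MeasureTheory.Integral.Bochner.Basic
import HarnessLib

/-!
# BF18 shell for functions (crux `ChaosClosesEuler`, stmt-AtomisticToContinuum-15141, line `Sketch`,
# stub `stub_bf18Shell`) — helper: the `L¹` distance from the two coercivity regimes, and `∫ √X`

WHAT. (1) `stub_bf18ShellL1Int` (registered sub-goal of the line): for reference data in a compact range
(`δ ≤ r ≤ P`, `0 ≤ Θ ≤ P`, `‖U‖ ≤ P`) there is ONE constant `L = L(P, c, δ) > 0` such that the `L¹`-type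
distance of the conserved variables `D = |ρ − r| + ‖m − rU‖ + |Eₜ − r(‖U‖²/2 + 3Θ/2)|` of any state
(`ρ ≥ 0`, `m`, total energy `Eₜ ≥ 0`, temperature `ϑ ≥ 0`; `m = 0` in the vacuum `ρ = 0`, and
`Eₜ = ‖m‖²/(2ρ) + 3ρϑ/2` when `ρ > 0`) is at most `L (X + √X)`, where `X ≥ 0` (the clamped relative
energy) is known only through its two coercivity regimes: NEAR the reference (`ρ > 0`, `|ρ−r| ≤ δ`,
`|ϑ−Θ| ≤ δ`) `c((ρ−r)² + (ϑ−Θ)²) + ‖m−ρU‖²/(2ρ) ≤ X`, and FAR from it (otherwise, vacuum included)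
`c(1 + ρ + Eₜ + ‖m−ρU‖²/(2ρ)) ≤ X`.  Near: `l1_dist_le_near` with the bound `P + δ` on `ρ`
(`l1_dist_le_near_of_abs_le`); far with `ρ > 0`: `l1_dist_le_far`, since `Eₜ ≥ 3ρϑ/2`
(`l1_dist_le_far_totalEnergy`); vacuum: `D ≤ P + P² + Eₜ + P(P²/2 + 3P/2)` while `c(1 + Eₜ) ≤ X`
(`l1_dist_le_vacuum`; in Lean `‖0 − 0•U‖²/(2·0) = 0`).
(2) The AM–GM step the shell uses to integrate `√X` over a window: `√y ≤ (λ + y/λ)/2`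
(`sqrt_le_half_add_div`), integrability of `√g` for an integrable `g` on a finite measure space
(`integrable_sqrt`), and `∫ √g ≤ (λ μ(univ) + (∫ g)/λ)/2` for `g ≥ 0` (a.e.) and `λ > 0`
(`integral_sqrt_le_of_ae`, `integral_sqrt_le`).

WHY. Last step of the BF18 relative-energy shell of the line: the window Grönwall inequality bounds `∫∫ X`
over a time window `W`; (1) and (2) turn it into the shell's conclusion `∫∫_W D ≤ L (A + (λ|W| + A/λ)/2)`
from `∫∫_W X ≤ A`.

No named fact is invoked.
-/

noncomputable section

namespace Summit.AtomisticToContinuum.HydrodynamicLimit.Theorems.ChaosClosesEulerShellL1Int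

open Real MeasureTheory
open Summit.AtomisticToContinuum.HydrodynamicLimit.Theorems.ChaosClosesEulerShell

/-! ### The three regimes, with constants depending only on `P`, `c`, `δ` -/

/-- **Near the reference, compact range.** If `0 < ρ`, `|ρ − r| ≤ δ`, `r ≤ P`, `0 ≤ Θ ≤ P`, `‖U‖ ≤ P`,
`0 < c`, `0 ≤ δ`, `0 ≤ X` and `c((ρ−r)² + (ϑ−Θ)²) + ‖m−ρU‖²/(2ρ) ≤ X`, then
`|ρ−r| + ‖m − rU‖ + |‖m‖²/(2ρ) + 3ρϑ/2 − r(‖U‖²/2 + 3Θ/2)| ≤ C₁ (X + √X)` with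
`C₁ = 1 + (1 + 4P' + P'²/2)/√c + (1+P')√(2P')`, `P' = P + δ` (`l1_dist_le_near` with `ρ ≤ r + δ ≤ P + δ`).
[folklore] -/
theorem l1_dist_le_near_of_abs_le (m U : EuclideanSpace ℝ (Fin 3)) {ρ r ϑ Θ P c δ X : ℝ} (hρ : 0 < ρ)
    (hρr : |ρ - r| ≤ δ) (hrP : r ≤ P) (hΘ0 : 0 ≤ Θ) (hΘP : Θ ≤ P) (hUP : ‖U‖ ≤ P) (hc : 0 < c)
    (hδ : 0 ≤ δ) (hX : 0 ≤ X)
    (hnear : c * ((ρ - r) ^ 2 + (ϑ - Θ) ^ 2) + ‖m - ρ • U‖ ^ 2 / (2 * ρ) ≤ X) :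
    |ρ - r| + ‖m - r • U‖ + |‖m‖ ^ 2 / (2 * ρ) + 3 / 2 * ρ * ϑ - r * (‖U‖ ^ 2 / 2 + 3 / 2 * Θ)| ≤
      (1 + (1 + 4 * (P + δ) + (P + δ) ^ 2 / 2) / Real.sqrt c +
          (1 + (P + δ)) * Real.sqrt (2 * (P + δ))) * (X + Real.sqrt X) := by
  have hρP : ρ ≤ P + δ := by
    have := (abs_le.1 hρr).2
    linarith
  exact l1_dist_le_near m U hρ hρP hΘ0 (hΘP.trans (le_add_of_nonneg_right hδ))
    (hUP.trans (le_add_of_nonneg_right hδ)) hc hX hnear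

/-- **Far from the reference, `ρ > 0`, in terms of the total energy.** If `0 < ρ`, `0 ≤ ϑ`, `0 ≤ r ≤ P`,
`0 ≤ Θ ≤ P`, `‖U‖ ≤ P`, `0 < c`, `Eₜ = ‖m‖²/(2ρ) + 3ρϑ/2` and `c(1 + ρ + Eₜ + ‖m−ρU‖²/(2ρ)) ≤ X`, then
`|ρ−r| + ‖m − rU‖ + |Eₜ − r(‖U‖²/2 + 3Θ/2)| ≤ (3 + P + 3P² + P³)/c · (X + √X)`
(`l1_dist_le_far`, using `Eₜ ≥ 3ρϑ/2` and `√X ≥ 0`). [folklore] -/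
theorem l1_dist_le_far_totalEnergy (m U : EuclideanSpace ℝ (Fin 3)) {ρ r ϑ Θ P c Et X : ℝ} (hρ : 0 < ρ)
    (hϑ : 0 ≤ ϑ) (hr0 : 0 ≤ r) (hrP : r ≤ P) (hΘ0 : 0 ≤ Θ) (hΘP : Θ ≤ P) (hUP : ‖U‖ ≤ P) (hc : 0 < c)
    (hEt : Et = ‖m‖ ^ 2 / (2 * ρ) + 3 / 2 * ρ * ϑ)
    (hfar : c * (1 + ρ + Et + ‖m - ρ • U‖ ^ 2 / (2 * ρ)) ≤ X) :
    |ρ - r| + ‖m - r • U‖ + |Et - r * (‖U‖ ^ 2 / 2 + 3 / 2 * Θ)| ≤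
      (3 + P + 3 * P ^ 2 + P ^ 3) / c * (X + Real.sqrt X) := by
  have hkin : 0 ≤ ‖m‖ ^ 2 / (2 * ρ) := by positivity
  have hle : 1 + ρ + ‖m - ρ • U‖ ^ 2 / (2 * ρ) + 3 / 2 * ρ * ϑ ≤ 1 + ρ + Et + ‖m - ρ • U‖ ^ 2 / (2 * ρ) := by
    rw [hEt]; linarith
  have hfar' : c * (1 + ρ + ‖m - ρ • U‖ ^ 2 / (2 * ρ) + 3 / 2 * ρ * ϑ) ≤ X :=
    (mul_le_mul_of_nonneg_left hle hc.le).trans hfar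
  have hP0 : 0 ≤ P := hr0.trans hrP
  have hC : 0 ≤ (3 + P + 3 * P ^ 2 + P ^ 3) / c := by positivity
  rw [hEt]
  exact (l1_dist_le_far m U hρ hϑ hr0 hrP hΘ0 hΘP hUP hc hfar').trans
    (mul_le_mul_of_nonneg_left (le_add_of_nonneg_right (Real.sqrt_nonneg X)) hC)

/-- **Vacuum.** If `0 ≤ r ≤ P`, `0 ≤ Θ ≤ P`, `‖U‖ ≤ P`, `0 < c`, `0 ≤ Eₜ` and `c(1 + Eₜ) ≤ X`, then the
distance of the vacuum state `(0, 0, Eₜ)` to the reference obeys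
`|0 − r| + ‖0 − rU‖ + |Eₜ − r(‖U‖²/2 + 3Θ/2)| ≤ (1 + P + 5P²/2 + P³/2)/c · X`. [folklore] -/
theorem l1_dist_le_vacuum (U : EuclideanSpace ℝ (Fin 3)) {r Θ P c Et X : ℝ} (hr0 : 0 ≤ r) (hrP : r ≤ P)
    (hΘ0 : 0 ≤ Θ) (hΘP : Θ ≤ P) (hUP : ‖U‖ ≤ P) (hc : 0 < c) (hEt0 : 0 ≤ Et)
    (hfar : c * (1 + Et) ≤ X) :
    |0 - r| + ‖(0 : EuclideanSpace ℝ (Fin 3)) - r • U‖ + |Et - r * (‖U‖ ^ 2 / 2 + 3 / 2 * Θ)| ≤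
      (1 + P + 5 / 2 * P ^ 2 + P ^ 3 / 2) / c * X := by
  have hP0 : 0 ≤ P := hr0.trans hrP
  have hU0 : 0 ≤ ‖U‖ := norm_nonneg _
  have h1 : |0 - r| = r := by rw [zero_sub, abs_neg, abs_of_nonneg hr0]
  have h2 : ‖(0 : EuclideanSpace ℝ (Fin 3)) - r • U‖ = r * ‖U‖ := by
    rw [zero_sub, norm_neg, norm_smul, Real.norm_eq_abs, abs_of_nonneg hr0]
  have hUU : ‖U‖ ^ 2 ≤ P ^ 2 := pow_le_pow_left₀ hU0 hUP 2
  have hb : 0 ≤ r * (‖U‖ ^ 2 / 2 + 3 / 2 * Θ) := by positivity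
  have hb' : r * (‖U‖ ^ 2 / 2 + 3 / 2 * Θ) ≤ P * (P ^ 2 / 2 + 3 / 2 * P) :=
    mul_le_mul hrP (by nlinarith) (by positivity) hP0
  have h3 : |Et - r * (‖U‖ ^ 2 / 2 + 3 / 2 * Θ)| ≤ Et + P * (P ^ 2 / 2 + 3 / 2 * P) := by
    rw [abs_le]; constructor <;> nlinarith
  have hrU : r * ‖U‖ ≤ P * P := mul_le_mul hrP hUP hU0 hP0
  have hG : 1 + Et ≤ X / c := by rw [le_div_iff₀ hc, mul_comm]; exact hfar
  rw [h1, h2]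
  calc r + r * ‖U‖ + |Et - r * (‖U‖ ^ 2 / 2 + 3 / 2 * Θ)|
      ≤ P + P * P + (Et + P * (P ^ 2 / 2 + 3 / 2 * P)) := by linarith
    _ ≤ (1 + P + 5 / 2 * P ^ 2 + P ^ 3 / 2) * (1 + Et) := by
        nlinarith [mul_nonneg hP0 hEt0, mul_nonneg (sq_nonneg P) hEt0, mul_nonneg (pow_nonneg hP0 3) hEt0]
    _ ≤ (1 + P + 5 / 2 * P ^ 2 + P ^ 3 / 2) * (X / c) := mul_le_mul_of_nonneg_left hG (by positivity)
    _ = (1 + P + 5 / 2 * P ^ 2 + P ^ 3 / 2) / c * X := by ring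

/-! ### The registered sub-goal -/

/-- REGISTERED SUB-GOAL `stub_bf18ShellL1Int` of the line `Sketch` (helper of `stub_bf18Shell`): one constant
`L = L(P, c, δ) > 0` converting the two coercivity regimes of the clamped relative energy `X ≥ 0`
(near: `c((ρ−r)² + (ϑ−Θ)²) + ‖m−ρU‖²/(2ρ) ≤ X`; far or vacuum: `c(1 + ρ + Eₜ + ‖m−ρU‖²/(2ρ)) ≤ X`) into
`|ρ−r| + ‖m − rU‖ + |Eₜ − r(‖U‖²/2 + 3Θ/2)| ≤ L (X + √X)`, for all states `ρ, ϑ, Eₜ ≥ 0` (`m = 0` if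
`ρ = 0`, `Eₜ = ‖m‖²/(2ρ) + 3ρϑ/2` if `ρ > 0`) and all reference data `δ ≤ r ≤ P`, `0 ≤ Θ ≤ P`, `‖U‖ ≤ P`.
Proof: `L = C₁ + C₂ + C₃`, the constants of `l1_dist_le_near_of_abs_le`, `l1_dist_le_far_totalEnergy`,
`l1_dist_le_vacuum`. [folklore] -/
theorem stub_bf18ShellL1Int : ∀ (P c δ : ℝ), 0 < c → 0 < δ → 0 ≤ P → ∃ L : ℝ, 0 < L ∧
    ∀ (m U : EuclideanSpace ℝ (Fin 3)) (ρ r ϑ Θ Et X : ℝ), δ ≤ r → r ≤ P → 0 ≤ Θ → Θ ≤ P → ‖U‖ ≤ P →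
      0 ≤ ρ → 0 ≤ ϑ → 0 ≤ Et → 0 ≤ X → (ρ = 0 → m = 0) →
      (0 < ρ → Et = ‖m‖ ^ 2 / (2 * ρ) + 3 / 2 * ρ * ϑ) →
      ((0 < ρ ∧ |ρ - r| ≤ δ ∧ |ϑ - Θ| ≤ δ) →
        c * ((ρ - r) ^ 2 + (ϑ - Θ) ^ 2) + ‖m - ρ • U‖ ^ 2 / (2 * ρ) ≤ X) →
      (¬(0 < ρ ∧ |ρ - r| ≤ δ ∧ |ϑ - Θ| ≤ δ) → c * (1 + ρ + Et + ‖m - ρ • U‖ ^ 2 / (2 * ρ)) ≤ X) →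
      |ρ - r| + ‖m - r • U‖ + |Et - r * (‖U‖ ^ 2 / 2 + 3 / 2 * Θ)| ≤ L * (X + Real.sqrt X) := by
  intro P c δ hc hδ hP
  -- the three constants (near / far / vacuum)
  set C₁ : ℝ := 1 + (1 + 4 * (P + δ) + (P + δ) ^ 2 / 2) / Real.sqrt c +
    (1 + (P + δ)) * Real.sqrt (2 * (P + δ)) with hC₁
  set C₂ : ℝ := (3 + P + 3 * P ^ 2 + P ^ 3) / c with hC₂
  set C₃ : ℝ := (1 + P + 5 / 2 * P ^ 2 + P ^ 3 / 2) / c with hC₃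
  have hδ0 : 0 ≤ δ := hδ.le
  have hC₁0 : 0 ≤ C₁ := by positivity
  have hC₂0 : 0 ≤ C₂ := by positivity
  have hC₃0 : 0 < C₃ := by positivity
  refine ⟨C₁ + C₂ + C₃, by positivity, ?_⟩
  intro m U ρ r ϑ Θ Et X hδr hrP hΘ0 hΘP hUP hρ0 hϑ0 hEt0 hX0 hvac hEt hnear hfar
  have hr0 : 0 ≤ r := hδ0.trans hδr
  have hXs : 0 ≤ X + Real.sqrt X := add_nonneg hX0 (Real.sqrt_nonneg X)
  -- it suffices to bound the distance by `Cᵢ (X + √X)` for one of the three constants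
  have hmono : ∀ C D : ℝ, C ≤ C₁ + C₂ + C₃ → D ≤ C * (X + Real.sqrt X) →
      D ≤ (C₁ + C₂ + C₃) * (X + Real.sqrt X) :=
    fun C D hC h => h.trans (mul_le_mul_of_nonneg_right hC hXs)
  rcases hρ0.eq_or_lt with hρ | hρ
  · -- vacuum: `ρ = 0`, hence `m = 0`, and the far regime applies
    subst hρ
    have hm : m = 0 := hvac rfl
    subst hm
    have hfar' : c * (1 + Et) ≤ X := by
      have h := hfar fun h => lt_irrefl _ h.1
      simpa using h
    refine hmono C₃ _ (by linarith) ?_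
    exact (l1_dist_le_vacuum U hr0 hrP hΘ0 hΘP hUP hc hEt0 hfar').trans
      (mul_le_mul_of_nonneg_left (le_add_of_nonneg_right (Real.sqrt_nonneg X)) hC₃0.le)
  · by_cases hreg : |ρ - r| ≤ δ ∧ |ϑ - Θ| ≤ δ
    · -- near the reference
      refine hmono C₁ _ (by linarith) ?_
      rw [hEt hρ]
      exact l1_dist_le_near_of_abs_le m U hρ hreg.1 hrP hΘ0 hΘP hUP hc hδ0 hX0 (hnear ⟨hρ, hreg⟩)
    · -- far from the reference, `ρ > 0`
      refine hmono C₂ _ (by linarith) ?_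
      exact l1_dist_le_far_totalEnergy m U hρ hϑ0 hr0 hrP hΘ0 hΘP hUP hc (hEt hρ)
        (hfar fun h => hreg h.2)

/-! ### Integrating `√X` over a window: AM–GM -/

/-- AM–GM for the square root: `√y ≤ (λ + y/λ)/2` for `0 ≤ y` and `0 < λ`
(from `(√y − λ)² ≥ 0`). [folklore] -/
theorem sqrt_le_half_add_div {y lam : ℝ} (hy : 0 ≤ y) (hlam : 0 < lam) :
    Real.sqrt y ≤ (lam + y / lam) / 2 := by
  obtain ⟨s, hs0, rfl⟩ : ∃ s : ℝ, 0 ≤ s ∧ y = s ^ 2 :=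
    ⟨Real.sqrt y, Real.sqrt_nonneg _, (Real.sq_sqrt hy).symm⟩
  rw [Real.sqrt_sq hs0]
  have key : 0 ≤ (s - lam) ^ 2 / lam := by positivity
  have e : (s - lam) ^ 2 / lam = (lam + s ^ 2 / lam) - 2 * s := by
    field_simp
    ring
  rw [e] at key
  linarith

/-- On a finite measure space, `√g` is integrable whenever `g` is (it is measurable and dominated by
`1 + |g|`). [folklore] -/
theorem integrable_sqrt {α : Type*} [MeasurableSpace α] {μ : Measure α} [IsFiniteMeasure μ] {g : α → ℝ}
    (hg : Integrable g μ) : Integrable (fun x => Real.sqrt (g x)) μ := by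
  refine Integrable.mono' ((integrable_const (1 : ℝ)).add hg.norm)
    (Real.continuous_sqrt.comp_aestronglyMeasurable hg.aestronglyMeasurable) (ae_of_all _ fun x => ?_)
  show ‖Real.sqrt (g x)‖ ≤ 1 + ‖g x‖
  rw [Real.norm_eq_abs, abs_of_nonneg (Real.sqrt_nonneg _), Real.norm_eq_abs]
  -- `√y ≤ 1 + |y|`: AM–GM for `y ≥ 0`, and `√y = 0` for `y ≤ 0`
  rcases le_or_gt 0 (g x) with hy | hy
  · have h := sqrt_le_half_add_div hy one_pos
    rw [div_one] at h
    rw [abs_of_nonneg hy]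
    linarith
  · rw [Real.sqrt_eq_zero'.2 hy.le]
    positivity

/-- **`∫ √g` by AM–GM (a.e. version).** On a finite measure space, if `0 ≤ g` a.e., `g` is integrable and
`λ > 0`, then `∫ √g dμ ≤ (λ μ(univ) + (∫ g dμ)/λ)/2`. [folklore] -/
theorem integral_sqrt_le_of_ae {α : Type*} [MeasurableSpace α] (μ : Measure α) [IsFiniteMeasure μ]
    {g : α → ℝ} (hg0 : 0 ≤ᵐ[μ] g) (hg : Integrable g μ) {lam : ℝ} (hlam : 0 < lam) :
    ∫ x, Real.sqrt (g x) ∂μ ≤ (lam * (μ Set.univ).toReal + (∫ x, g x ∂μ) / lam) / 2 := by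
  have hint : Integrable (fun x => (lam + g x / lam) / 2) μ :=
    ((integrable_const lam).add (hg.div_const lam)).div_const 2
  calc ∫ x, Real.sqrt (g x) ∂μ ≤ ∫ x, (lam + g x / lam) / 2 ∂μ :=
        integral_mono_ae (integrable_sqrt hg) hint
          (hg0.mono fun x hx => sqrt_le_half_add_div hx hlam)
    _ = (lam * (μ Set.univ).toReal + (∫ x, g x ∂μ) / lam) / 2 := by
        rw [integral_div, integral_add (integrable_const lam) (hg.div_const lam), integral_const,
          integral_div, measureReal_def, smul_eq_mul, mul_comm]

/-- **`∫ √g` by AM–GM.** On a finite measure space, if `0 ≤ g`, `g` is integrable and `λ > 0`, then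
`∫ √g dμ ≤ (λ μ(univ) + (∫ g dμ)/λ)/2`. [folklore] -/
theorem integral_sqrt_le {α : Type*} [MeasurableSpace α] (μ : Measure α) [IsFiniteMeasure μ]
    {g : α → ℝ} (hg0 : ∀ x, 0 ≤ g x) (hg : Integrable g μ) {lam : ℝ} (hlam : 0 < lam) :
    ∫ x, Real.sqrt (g x) ∂μ ≤ (lam * (μ Set.univ).toReal + (∫ x, g x ∂μ) / lam) / 2 :=
  integral_sqrt_le_of_ae μ (ae_of_all μ hg0) hg hlam

end Summit.AtomisticToContinuum.HydrodynamicLimit.Theorems.ChaosClosesEulerShellL1Int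

end
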